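import Summits.RiemannHypothesis.RiemannHypothesis.Theorems.HandoffSemilocalEnergy
import Summits.RiemannHypothesis.RiemannHypothesis.Theorems.HandoffEdgeLayer
import HarnessLib

/-!
# HANDOFF — the AGGREGATE objects typed (2/2): the RH-free sandwich `|ε − λ_min(S_q)| ≤ cap(q)` on the window, the continuum `N(q)`, and the load ceiling `r(q) ≤ 1` (cell rh-explicit, TRACK «HANDOFF», seat theory-2)

HONEST FRAMING. Nothing here proves or approaches RH; NO definitions in this file (theorems only). Part 1/2 (`HandoffSemilocalEnergy.lean`) typed the semi-local
ground energy `λ_min(S; b; σ)`, the aggregate deficit `D_q(b) = −λ_min(S_q; b)`, the load `r(q)`, and proved boundedness, monotonicity,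
`sign = threshold` and locality. Here, for consecutive primes `q < q'` and `b ≤ (log q')/2`:

* §5 the RH-free SANDWICH `|ε_σ(b) − λ_min(S_q; b; σ)| ≤ cap(q)`, `cap(q) = (log q)/√q`: inserting the place `q` moves the
  bottom of the spectrum by at most the cap (pointwise identity `Re Q = contribution − deficit` of `HandoffWindow.lean` + the
  sharp edge-layer bound `|contribution_q(g)| ≤ cap(q)‖g‖₂²` of `HandoffEdgeLayer.lean`); in `D`-language
  `−cap(q) ≤ D_q(b) + ε(b) ≤ cap(q)` — so a certified `D_q(b) > cap(q)` at some `b ≤ (log q')/2` is `ε(b) < 0`, i.e. `¬RH`;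
* §6 for the LOAD `r(q) = D_q((log q')/2)/cap(q)` (`handoffLoad`, part 1; conj-1's sealed object), under `H(q)`: `D_q(b) ≤ cap(q) − ε(b)`
  with `ε(b) ≥ 0` on the window (the continuum `N = ∞` form of HANDOFF-STATEMENT §D.2 with its margin, §H.6 (ii)),
  **`r(q) ≤ 1 − ε((log q')/2)/cap(q) ≤ 1`**, `RH ⟹ r(q) ≤ 1` for every consecutive pair; and the SIGN of the load is the
  cell's RH-free UPPER clause: `0 < r(q) ↔ a*(S_q) < (log q')/2`.

References (as printed): E. Bombieri, Rend. Mat. Acc. Lincei (9) 11 (2000) Thm 2 (p. 193), §4 (`Bombieri2000Weil`);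
A. Connes, C. Consani, Enseign. Math. 69 (2023) §2.2–2.3 (the contribution of the new prime; `ConnesConsani2023`).
-/

set_option linter.dupNamespace false  -- the mandated namespace repeats `RiemannHypothesis`

noncomputable section

open Set Filter Complex MeasureTheory Literature.NumberTheory.LFunctions
open Summit.RiemannHypothesis.RiemannHypothesis.Theorems.Handoff
open Summit.RiemannHypothesis.RiemannHypothesis.Theorems.HandoffEdgeLayer
open Summit.RiemannHypothesis.RiemannHypothesis.Theorems.HandoffAnalytic
open Summit.RiemannHypothesis.RiemannHypothesis.Theorems.HandoffSemilocalEnergy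
open Summit.RiemannHypothesis.RiemannHypothesis.Theorems.MotivicDoor.SemilocalThreshold
open scoped Real ComplexConjugate

namespace Summit.RiemannHypothesis.RiemannHypothesis.Theorems.HandoffLoadCeiling

variable {g : ℝ → ℂ} {P : (ℝ → ℂ) → Prop} {a b x : ℝ} {q q' : ℕ}

/-! ## §5  The RH-free sandwich on the window: the place `q` moves the bottom by at most `cap(q)` -/

/-- Pointwise: `Re Q_{S_q}(g) − cap(q)‖g‖₂² ≤ Re Q(g) ≤ Re Q_{S_q}(g) + cap(q)‖g‖₂²` for `g ∈ C(b)`, `b ≤ (log q')/2`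
(the identity `Re Q = contribution − deficit` and the sharp edge-layer bound `|contribution| ≤ cap‖g‖₂²`). [folklore] -/
theorem abs_re_weilQuadratic_sub_re_weilSemilocalQuadratic_le (h : ConsecutivePrimes q q') (hg : IsWeilTest g)
    (hb : b ≤ Real.log q' / 2) (hsupp : tsupport g ⊆ Icc (-b) b) :
    |(weilQuadratic g).re - (weilSemilocalQuadratic (Nat.primesBelow q) g).re| ≤
      Real.log q / Real.sqrt q * ∫ t, ‖g t‖ ^ 2 := by
  have hid := re_weilQuadratic_eq_contribution_sub_deficit h hg
    (hsupp.trans (Icc_subset_Icc (neg_le_neg hb) hb))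
  have hcap := abs_contribution_le_of_window h hg hb hsupp
  have : (weilQuadratic g).re - (weilSemilocalQuadratic (Nat.primesBelow q) g).re = contribution q g := by
    rw [hid]; unfold deficit; ring
  rwa [this]

/-- **The sandwich, lower half**: `λ_min(S_q; b; P) − cap(q) ≤ inf (full form, P-sphere of b)` for `b ≤ (log q')/2`
and any sector whose sphere is nonempty. [folklore] -/
theorem semilocalGroundEnergy_sub_cap_le (h : ConsecutivePrimes q q') (hb : b ≤ Real.log q' / 2)
    (hne : (weilWindowSphereValues P b).Nonempty) :
    semilocalGroundEnergy (Nat.primesBelow q) P b - Real.log q / Real.sqrt q ≤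
      sInf (weilWindowSphereValues P b) := by
  refine le_sInf_weilWindowSphereValues hne fun g hg hs hP hn ↦ ?_
  have h1 := abs_re_weilQuadratic_sub_re_weilSemilocalQuadratic_le h hg hb hs
  rw [hn, mul_one] at h1
  have h2 := semilocalGroundEnergy_le_re (S := Nat.primesBelow q) hg hs hP hn
  linarith [(abs_le.1 h1).1]

/-- **The sandwich, upper half**: `inf (full form, P-sphere of b) ≤ λ_min(S_q; b; P) + cap(q)` for `b ≤ (log q')/2`. [folklore] -/
theorem sInf_le_semilocalGroundEnergy_add_cap (h : ConsecutivePrimes q q') (hb : b ≤ Real.log q' / 2)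
    (hne : (weilWindowSphereValues P b).Nonempty) :
    sInf (weilWindowSphereValues P b) ≤
      semilocalGroundEnergy (Nat.primesBelow q) P b + Real.log q / Real.sqrt q := by
  have hne' : (semilocalSphereValues (Nat.primesBelow q) P b).Nonempty :=
    (semilocalSphereValues_nonempty_iff _ P b).2 hne
  have key : sInf (weilWindowSphereValues P b) - Real.log q / Real.sqrt q ≤
      semilocalGroundEnergy (Nat.primesBelow q) P b := by
    refine le_semilocalGroundEnergy hne' fun g hg hs hP hn ↦ ?_
    have h1 := abs_re_weilQuadratic_sub_re_weilSemilocalQuadratic_le h hg hb hs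
    rw [hn, mul_one] at h1
    have h2 := sInf_weilWindowSphereValues_le_re hg hs hP hn
    linarith [(abs_le.1 h1).2]
  linarith

/-- **`|ε(b) − λ_min(S_q; b)| ≤ cap(q)`** on `0 < b ≤ (log q')/2`: inserting the place `q` moves the bottom of the
spectrum by at most the cap — the GAIN `G_q(b) = ε(b) − λ_min(S_q; b)` of HANDOFF-STATEMENT §H.3 lies in `[−cap, cap]`,
RH-free. In `D`-language: `−cap(q) ≤ D_q(b) + ε(b) ≤ cap(q)`. [folklore] -/
theorem abs_weilGroundEnergy_sub_semilocalGroundEnergy_le_cap (h : ConsecutivePrimes q q') (hb0 : 0 < b)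
    (hb : b ≤ Real.log q' / 2) :
    |weilGroundEnergy b - semilocalGroundEnergy (Nat.primesBelow q) (fun _ ↦ True) b| ≤
      Real.log q / Real.sqrt q := by
  have hne := weilWindowSphereValues_top_nonempty hb0
  have h1 := semilocalGroundEnergy_sub_cap_le (P := fun _ ↦ True) h hb hne
  have h2 := sInf_le_semilocalGroundEnergy_add_cap (P := fun _ ↦ True) h hb hne
  rw [← weilGroundEnergy_eq_sInf] at h1 h2
  exact abs_le.2 ⟨by linarith, by linarith⟩

/-- `D_q(b) + ε(b) ≤ cap(q)` for `0 < b ≤ (log q')/2` (RH-free). [folklore] -/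
theorem aggregateDeficit_add_weilGroundEnergy_le_cap (h : ConsecutivePrimes q q') (hb0 : 0 < b)
    (hb : b ≤ Real.log q' / 2) :
    aggregateDeficit q b + weilGroundEnergy b ≤ Real.log q / Real.sqrt q := by
  have := (abs_le.1 (abs_weilGroundEnergy_sub_semilocalGroundEnergy_le_cap h hb0 hb)).2
  unfold aggregateDeficit
  linarith

/-- `−cap(q) ≤ D_q(b) + ε(b)` for `0 < b ≤ (log q')/2` (RH-free): a large deficit of the old form drags Weil's ground energy
down by at least `D_q(b) − cap(q)` — so a CERTIFIED `D_q(b) > cap(q)` at some `b ≤ (log q')/2` is `ε(b) < 0`, i.e. `¬RH`. [folklore] -/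
theorem neg_cap_le_aggregateDeficit_add_weilGroundEnergy (h : ConsecutivePrimes q q') (hb0 : 0 < b)
    (hb : b ≤ Real.log q' / 2) :
    -(Real.log q / Real.sqrt q) ≤ aggregateDeficit q b + weilGroundEnergy b := by
  have := (abs_le.1 (abs_weilGroundEnergy_sub_semilocalGroundEnergy_le_cap h hb0 hb)).1
  unfold aggregateDeficit
  linarith

/-! ## §6  Under `H(q)` / RH: the aggregate necessary condition `N(q)` and the load ceiling `r(q) ≤ 1` -/

/-- `cap(q) = (log q)/√q > 0` for `q ≥ 2`. [folklore] -/
theorem cap_pos (hq : 2 ≤ q) : 0 < Real.log q / Real.sqrt q := by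
  have hq' : (1 : ℝ) < q := by exact_mod_cast hq
  exact div_pos (Real.log_pos hq') (Real.sqrt_pos.2 (by linarith))

/-- **`H(q) ⟹ D_q(b) ≤ cap(q) − ε(b)` on the window** (`b ∈ [(log q)/2, (log q')/2]`), with `0 ≤ ε(b)`: the aggregate
necessary condition `N(q)` WITH its margin (HANDOFF-STATEMENT §D.2, §H.6 (ii)). [cite: Bombieri2000Weil, §4 (windows); this track] -/
theorem aggregateDeficit_le_cap_sub_of_handoffH (h : ConsecutivePrimes q q') (H : HandoffH q q')
    (hb : b ∈ Icc (Real.log q / 2) (Real.log q' / 2)) :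
    aggregateDeficit q b ≤ Real.log q / Real.sqrt q - weilGroundEnergy b ∧ 0 ≤ weilGroundEnergy b := by
  have hq1 : (1 : ℝ) < q := by exact_mod_cast h.1.one_lt
  have hb0 : 0 < b := lt_of_lt_of_le (div_pos (Real.log_pos hq1) two_pos) hb.1
  have hW : WeilPositivityOn b :=
    ((handoffH_iff_weilPositivityOn h).1 H).mono hb.2
  refine ⟨by linarith [aggregateDeficit_add_weilGroundEnergy_le_cap h hb0 hb.2],
    (weilGroundEnergy_nonneg_iff_holds hb0).2 hW⟩

/-- **`H(q) ⟹ N(q)`: `D_q(b) ≤ cap(q)`** for every `b` in the window — the continuum (`N = ∞`) form of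
`deficit_le_cap_of_handoffH`. [cite: Bombieri2000Weil, §4 (windows); this track] -/
theorem aggregateDeficit_le_cap_of_handoffH (h : ConsecutivePrimes q q') (H : HandoffH q q')
    (hb : b ∈ Icc (Real.log q / 2) (Real.log q' / 2)) :
    aggregateDeficit q b ≤ Real.log q / Real.sqrt q := by
  obtain ⟨h1, h2⟩ := aggregateDeficit_le_cap_sub_of_handoffH h H hb
  linarith

/-- **`H(q) ⟹ r(q) ≤ 1 − ε((log q')/2)/cap(q)`** (HANDOFF-STATEMENT §H.6 (ii): «r < 1» and «r ≤ 1» differ by `ε/cap`). [this track] -/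
theorem handoffLoad_le_one_sub_of_handoffH (h : ConsecutivePrimes q q') (H : HandoffH q q') :
    handoffLoad q q' ≤ 1 - weilGroundEnergy (Real.log q' / 2) / (Real.log q / Real.sqrt q) := by
  have hcap := cap_pos h.1.two_le
  have hqq' : Real.log q / 2 ≤ Real.log q' / 2 := by
    have : (q : ℝ) ≤ q' := by exact_mod_cast h.2.2.1.le
    have hq : (0 : ℝ) < q := by exact_mod_cast h.1.pos
    linarith [Real.log_le_log hq this]
  obtain ⟨h1, -⟩ := aggregateDeficit_le_cap_sub_of_handoffH h H ⟨hqq', le_rfl⟩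
  rw [handoffLoad, div_le_iff₀ hcap, sub_mul, one_mul, div_mul_cancel₀ _ hcap.ne']
  exact h1

/-- **`H(q) ⟹ r(q) ≤ 1`** — conj-1's ceiling, THEOREM-grade under `H(q)`. [this track] -/
theorem handoffLoad_le_one_of_handoffH (h : ConsecutivePrimes q q') (H : HandoffH q q') : handoffLoad q q' ≤ 1 := by
  have hcap := cap_pos h.1.two_le
  have h1 := handoffLoad_le_one_sub_of_handoffH h H
  have h2 : 0 ≤ weilGroundEnergy (Real.log q' / 2) := (handoffH_iff_weilGroundEnergy_nonneg h).1 H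
  have h3 : 0 ≤ weilGroundEnergy (Real.log q' / 2) / (Real.log q / Real.sqrt q) := div_nonneg h2 hcap.le
  linarith

/-- **RH ⟹ `r(q) ≤ 1` for every pair of consecutive primes** (a certified load `> 1` anywhere refutes RH). [cite: Bombieri2000Weil, Thm 2 (p. 193); this track] -/
theorem forall_handoffLoad_le_one_of_riemannHypothesis (hRH : RiemannHypothesis) :
    ∀ q q' : ℕ, ConsecutivePrimes q q' → handoffLoad q q' ≤ 1 :=
  fun q q' h ↦ handoffLoad_le_one_of_handoffH h ((riemannHypothesis_iff_forall_handoffH.1 hRH) q q' h)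

/-- **The SIGN of the load is the RH-free UPPER clause** of the cell's book-keeping: `0 < r(q) ↔ a*(S_q) < (log q')/2`
(«the old form fails before the next prime arrives»; certified for `q ≤ 59`, HANDOFF-STATEMENT §B.4 (iv)). [this track] -/
theorem handoffLoad_pos_iff (h : ConsecutivePrimes q q') :
    0 < handoffLoad q q' ↔ weilSemilocalThreshold (Nat.primesBelow q) < Real.log q' / 2 := by
  rw [handoffLoad, div_pos_iff_of_pos_right (cap_pos h.1.two_le), aggregateDeficit_pos_iff]

/-- Dictionary with the wall offset: `r(q) ≤ 0 ↔ (log q')/2 ≤ a*(S_q)` — i.e. the load is non-positive exactly when the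
OLD form is still positive at the END of the window (never observed: every certified wall has `a*(S_q) < (log q')/2`). [this track] -/
theorem handoffLoad_nonpos_iff (h : ConsecutivePrimes q q') :
    handoffLoad q q' ≤ 0 ↔ Real.log q' / 2 ≤ weilSemilocalThreshold (Nat.primesBelow q) := by
  rw [← not_lt, handoffLoad_pos_iff h, not_lt]

end Summit.RiemannHypothesis.RiemannHypothesis.Theorems.HandoffLoadCeiling

end
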